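import Literature.NumberTheory.EllipticCurves.ManinSymbolsWeightKGamma1RankProofs
import Literature.NumberTheory.EllipticCurves.ModularFormsGamma1OddDimension
import Literature.NumberTheory.EllipticCurves.ModularFormsGamma1PlusMinus
import Literature.NumberTheory.EllipticCurves.DeligneSerreProp27WeightReductionProofs
import HarnessLib

/-!
# The rank half of Eichler–Shimura for `Γ₁(N)` in every weight (`N ≥ 5`): signed boundary
# symbols, and Deligne–Serre (2.7.2) at all levels `N ≥ 5`

`ManinSymbolsWeightKGamma1RankProofs` treated even `n` with unsigned orbit indicators on
`SL(2, ℤ)/Γ'`, `-1 ∈ Γ'`.  For odd `n` the boundary value of a weight-`(n+2)` symbol at a cusp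
depends on the orientation of the primitive vector (`P(-v) = (-1)ⁿP(v)`; Merel 1994, §1.4: the
relation `[λu] = (λ/|λ|)ᵏ[u]` on `ℂ[Γ\ℚ²]`).  Here the boundary is recorded on `X = SL(2, ℤ)/Γ` itself
by the **signed orbit indicators** `sind x = 𝟙_{orbit x} + (-1)ⁿ 𝟙_{orbit (-x)}` (the vector
`g⁻¹e₁` of the coset `x = gΓ` has stabiliser exactly `⟨T⟩`), and the boundary symbol is
`∂[x, q] = q₁ⁿ sind x - (-q₀)ⁿ sind(S⁻¹x)` — a `PolySymbol` for **every** `n ≥ 1` and every `Γ`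
(`sbdrySymbol`).  The rest of the argument of the even case goes through verbatim:

* `range_total_sbdrySymbol`, `total_sbdry_chainMM` (`q₁ⁿ sind[k⁻¹Γ] - (kq)₁ⁿ sind[Γ]`),
  `total_sbdry_heckeChain` (Manin–Drinfeld factor `1 + p^{n+1}` for `p ≡ 1 mod N`),
  **`finrank_span_periodLatticeK1_add_le'`**: `dim_ℚ ℚΛ + dim ⟨sind⟩ ≤ dim(M/rel)`;
* `card_basePoints_le_finrank_span_sind`: for `N ≥ 5` (no coset with `Tⁱx = -x`,
  `T_pow_smul_ne_neg_smul_gamma1` of `ModularFormsGamma1OddDimension`) the signed indicators of lifts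
  of the base points of `SL(2, ℤ)/±Γ₁(N)` are linearly independent, so
  `dim ⟨sind⟩ ≥ ε_∞ = #Level.basePoints(±Γ₁(N))`;
* with the all-weight dimension bound `(k - 1)[SL(2, ℤ) : ±Γ₁(N)] - 6ε_∞ ≤ 12 dim S_k(Γ₁(N))`
  (`le_twelve_mul_finrank_cuspForm_gamma1_all`, `N ≥ 5`): **`finrank_span_periodLatticeK1_le_two_mul'`**,
  **`periodLatticeK1_eq_span_fin_two_mul'`** — the rank half `rank_ℤ Λ ≤ 2 dim_ℂ S_{n+2}(Γ₁(N))`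
  for every `n ≥ 1` and `N ≥ 5` (Shimura 1971, Thm. 8.4, (8.2.23): both parities);
* `nonempty_heckeStableRealLattice'` (`n ≥ 5`, `N ≥ 5`) and
  **`span_integralLattice1_of_five_le`**: Deligne–Serre's (2.7.2)
  `DeligneSerre1974_span_integralLattice1 N k` for **every weight `k` and every level `N ≥ 5`**
  (weights `≥ 7` by Shimura's Thm. 3.52, the rest by the `E₄`/`E₆` descent `of_forall_le`).

Everything is proved; no named facts.  The levels `N ≤ 4` are not covered (`N ≤ 3`: elliptic
points; `N = 4`: the irregular cusp `1/2` in odd weight).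

## References

* L. Merel, *Universal Fourier expansions of modular forms*, LNM 1585 (1994), §1.4 Prop. 4–6.
* G. Shimura, *Introduction to the arithmetic theory of automorphic functions* (1971), (3.5.20),
  Thm. 3.52, §8.2 Thm. 8.4, (8.2.23), (8.2.24) (`η_k` for regular/irregular cusps).
* P. Deligne, J.-P. Serre, *Formes modulaires de poids 1* (1974), Prop. 2.7 (2.7.2), Rem. 2.8.
-/

noncomputable section

namespace Literature.NumberTheory.EllipticCurves.ModularForms

namespace ManinK

open Matrix.SpecialLinearGroup ModularGroup CongruenceSubgroup
open scoped MatrixGroups ModularForm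

/-! ### Signed orbit indicators -/

section SInd

variable (n : ℕ) (Γ : Subgroup SL(2, ℤ))

/-- The **signed orbit indicator** of a coset: `𝟙_{orbit x} + (-1)ⁿ 𝟙_{orbit (-x)}` (the boundary
class of the primitive vector `g⁻¹e₁` of `x = gΓ`, with `[-v] = (-1)ⁿ[v]`). [cite: Merel1994, §1.4 Prop. 4] -/
def sind (x : Coset Γ) : Coset Γ → ℚ := tind Γ x + ((-1 : ℚ) ^ n) • tind Γ ((-1 : SL(2, ℤ)) • x)

variable {n Γ}

/-- Unfolding `sind`. [folklore] -/
theorem sind_def (x : Coset Γ) :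
    sind n Γ x = tind Γ x + ((-1 : ℚ) ^ n) • tind Γ ((-1 : SL(2, ℤ)) • x) := rfl

/-- `sind` is constant on `⟨T⟩`-orbits. [folklore] -/
theorem sind_T_zpow_smul (m : ℤ) (x : Coset Γ) : sind n Γ (T ^ m • x) = sind n Γ x := by
  rw [sind_def, sind_def, ← mul_smul, show (-1 : SL(2, ℤ)) * T ^ m = T ^ m * (-1) by
    rw [neg_one_mul, mul_neg_one], mul_smul, tind_T_zpow_smul, tind_T_zpow_smul]

/-- `sind (T x) = sind x`. [folklore] -/
theorem sind_T_smul (x : Coset Γ) : sind n Γ (T • x) = sind n Γ x := by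
  simpa using sind_T_zpow_smul (n := n) 1 x

/-- `sind (T⁻¹ x) = sind x`. [folklore] -/
theorem sind_T_inv_smul (x : Coset Γ) : sind n Γ (T⁻¹ • x) = sind n Γ x := by
  simpa using sind_T_zpow_smul (n := n) (-1) x

/-- **`sind(-x) = (-1)ⁿ sind x`.** [folklore] -/
theorem sind_neg_one_smul (x : Coset Γ) : sind n Γ ((-1 : SL(2, ℤ)) • x) = ((-1 : ℚ) ^ n) • sind n Γ x := by
  rw [sind_def, sind_def, ← mul_smul, neg_mul_neg, one_mul, one_smul, smul_add, ← mul_smul,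
    ← pow_add, ← two_mul, pow_mul]
  norm_num
  abel

/-- `sind(-g x) = (-1)ⁿ sind(g x)`. [folklore] -/
theorem sind_neg_smul (g : SL(2, ℤ)) (x : Coset Γ) :
    sind n Γ ((-g) • x) = ((-1 : ℚ) ^ n) • sind n Γ (g • x) := by
  rw [← neg_one_mul, mul_smul, sind_neg_one_smul]

end SInd

/-! ### The signed boundary symbol system (every `n ≥ 1`) -/

section SBdry

variable (n : ℕ) (Γ : Subgroup SL(2, ℤ))

/-- **The signed boundary symbol** `∂[x, q] = q₁ⁿ sind x - (-q₀)ⁿ sind(S⁻¹x)` (Merel 1994, Prop. 6: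
`∂[P, g] = P(1,0)[Γg(1,0)ᵗ] - P(0,1)[Γg(0,1)ᵗ]`, the values of `det(·, q)ⁿ` at `e₁` and `Se₁` being
`q₁ⁿ` and `(-q₀)ⁿ`). [cite: Merel1994, §1.4 Prop. 6] -/
def sbdryFun (x : Coset Γ) (q : Fin 2 → ℤ) : Coset Γ → ℚ :=
  ((q 1 : ℚ) ^ n) • sind n Γ x - ((-(q 0 : ℚ)) ^ n) • sind n Γ (S⁻¹ • x)

/-- Unfolding `sbdryFun`. [folklore] -/
theorem sbdryFun_def (x : Coset Γ) (q : Fin 2 → ℤ) : sbdryFun n Γ x q =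
    ((q 1 : ℚ) ^ n) • sind n Γ x - ((-(q 0 : ℚ)) ^ n) • sind n Γ (S⁻¹ • x) := rfl

variable {n}

/-- **The signed boundary symbols form a system of Manin symbols for every `n ≥ 1`.**
[cite: Merel1994, §1.4 Prop. 5 and Prop. 6] -/
def sbdrySymbol (hn1 : 1 ≤ n) : PolySymbol n Γ (Coset Γ → ℚ) where
  toFun := sbdryFun n Γ
  poly x := by
    refine ⟨fun j ↦ if j = 0 then sind n Γ x else
      if j = n then -((-1 : ℚ) ^ n) • sind n Γ (S⁻¹ • x) else 0, fun q ↦ ?_⟩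
    have hn0 : n ≠ 0 := by omega
    rw [sbdryFun_def, Finset.sum_eq_add_of_mem (a := 0) (b := n) (Finset.mem_range.mpr (by omega))
      (Finset.mem_range.mpr (by omega)) (by omega)]
    · simp only [mono_apply, pow_zero, Nat.sub_zero, one_mul, if_true, Nat.sub_self, mul_one,
        if_neg hn0, smul_smul]
      rw [neg_pow, sub_eq_add_neg, ← neg_smul]
      congr 2
      ring
    · intro j _ hj
      rcases hj with ⟨hj0, hjn⟩
      simp [hj0, hjn]
  two_term x q := by
    rw [sbdryFun_def, sbdryFun_def, ← mul_smul, ← mul_inv_rev, S_mul_S_eq_neg_one, inv_neg, inv_one,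
      sind_neg_one_smul, act_S_inv]
    simp only [Matrix.cons_val_one, Matrix.cons_val_zero, Int.cast_neg, smul_smul]
    have h1 : (-(q 1 : ℚ)) ^ n * (-1 : ℚ) ^ n = (q 1 : ℚ) ^ n := by
      rw [← mul_pow]; ring_nf
    rw [h1]
    abel
  three_term x q := by
    have g1 : S⁻¹ * (T * S)⁻¹ = -T⁻¹ := by decide
    have g2 : (T * S)⁻¹ * (T * S)⁻¹ = T * S⁻¹ := by decide
    have g3 : S⁻¹ * ((T * S)⁻¹ * (T * S)⁻¹) = -(T⁻¹ * (T * S)⁻¹) := by decide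
    have e1 : sind n Γ (S⁻¹ • (T * S)⁻¹ • x) = ((-1 : ℚ) ^ n) • sind n Γ x := by
      rw [← mul_smul, g1, sind_neg_smul, sind_T_inv_smul]
    have e2 : sind n Γ ((T * S)⁻¹ • (T * S)⁻¹ • x) = sind n Γ (S⁻¹ • x) := by
      rw [← mul_smul, g2, mul_smul, sind_T_smul]
    have e3 : sind n Γ (S⁻¹ • (T * S)⁻¹ • (T * S)⁻¹ • x) = ((-1 : ℚ) ^ n) • sind n Γ ((T * S)⁻¹ • x) := by
      rw [← mul_smul (T * S)⁻¹, ← mul_smul, g3, sind_neg_smul, mul_smul, sind_T_inv_smul]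
    rw [sbdryFun_def, sbdryFun_def, sbdryFun_def, e1, e2, e3, act_TS_inv, act_TS_inv]
    simp only [Matrix.cons_val_one, Matrix.cons_val_zero, Int.cast_sub, smul_smul]
    have h1 : (-(q 1 : ℚ)) ^ n * (-1 : ℚ) ^ n = (q 1 : ℚ) ^ n := by
      rw [← mul_pow]; ring_nf
    have h2 : (-((q 1 : ℚ) - q 0)) ^ n * (-1 : ℚ) ^ n = ((q 1 : ℚ) - q 0) ^ n := by
      rw [← mul_pow]; ring_nf
    rw [h1, h2]
    abel
  neg x q := by
    have hc : S⁻¹ • (-1 : SL(2, ℤ)) • x = (-1 : SL(2, ℤ)) • S⁻¹ • x := by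
      rw [← mul_smul, ← mul_smul, mul_neg_one, neg_one_mul]
    rw [sbdryFun_def, sbdryFun_def, hc, sind_neg_one_smul, sind_neg_one_smul]
    simp only [Pi.neg_apply, Int.cast_neg, neg_neg, smul_smul]
    have h1 : (-(q 1 : ℚ)) ^ n * (-1 : ℚ) ^ n = (q 1 : ℚ) ^ n := by
      rw [← mul_pow]; ring_nf
    have h2 : (q 0 : ℚ) ^ n * (-1 : ℚ) ^ n = (-(q 0 : ℚ)) ^ n := by
      rw [← mul_pow]; ring_nf
    rw [h1, h2]

/-- Unfolding the signed boundary symbols. [folklore] -/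
@[simp] theorem sbdrySymbol_toFun (hn1 : 1 ≤ n) : (sbdrySymbol Γ hn1).toFun = sbdryFun n Γ := rfl

variable [Γ.FiniteIndex]

/-- **The signed boundary symbols span exactly the signed orbit indicators.** [cite: Merel1994, §1.4 Prop. 5] -/
theorem range_total_sbdrySymbol (hn1 : 1 ≤ n) :
    LinearMap.range (sbdrySymbol Γ hn1).total = Submodule.span ℚ (Set.range (sind n Γ)) := by
  classical
  apply le_antisymm
  · refine PolySymbol.range_total_le _ _ fun x q ↦ ?_
    rw [sbdrySymbol_toFun, sbdryFun_def]
    exact sub_mem (Submodule.smul_mem _ _ (Submodule.subset_span ⟨_, rfl⟩))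
      (Submodule.smul_mem _ _ (Submodule.subset_span ⟨_, rfl⟩))
  · rw [Submodule.span_le]
    rintro _ ⟨y, rfl⟩
    refine ⟨Pi.single y (ev n ![0, 1]), ?_⟩
    rw [PolySymbol.total_single, sbdrySymbol_toFun, sbdryFun_def]
    simp [zero_pow (by omega : n ≠ 0)]

end SBdry

/-! ### The boundary of the chains, and Manin–Drinfeld -/

section SChain

variable {N : ℕ} [NeZero N] {n : ℕ} (hn1 : 1 ≤ n)

omit [NeZero N] in
/-- The signed indicator of the coset of an upper-triangular matrix, with the sign of its diagonal:
`sind[k⁻¹] = d ⁿ sind[1]` for `k = (a b; 0 d)`, matching `(kq)₁ⁿ = dⁿ q₁ⁿ`. [folklore] -/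
theorem sind_mk_inv_of_apply_one_zero {k : SL(2, ℤ)} (hz : k 1 0 = 0) (q : Fin 2 → ℤ) :
    (((q 1 : ℤ) : ℚ) ^ n) • sind n (Gamma1 N) ((k⁻¹ : SL(2, ℤ)) : Coset (Gamma1 N)) =
      (((act k q 1 : ℤ) : ℚ) ^ n) • sind n (Gamma1 N) ((1 : SL(2, ℤ)) : Coset (Gamma1 N)) := by
  have hdet : k 0 0 * k 1 1 = 1 := by
    have := Matrix.SpecialLinearGroup.det_coe k
    rw [Matrix.det_fin_two, hz, mul_zero, sub_zero] at this
    exact this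
  rw [act_apply_one, hz, zero_mul, zero_add]
  rcases Int.eq_one_or_neg_one_of_mul_eq_one hdet with ha | ha
  · have hd : k 1 1 = 1 := by rw [ha, one_mul] at hdet; exact hdet
    have hk : k = T ^ (k 0 1) := by
      ext i j
      fin_cases i <;> fin_cases j <;> simp [ModularGroup.coe_T_zpow, ha, hd, hz]
    rw [hd, one_mul]
    congr 1
    rw [hk, ← zpow_neg, show (((T ^ (-(k 0 1))) : SL(2, ℤ)) : Coset (Gamma1 N)) =
      T ^ (-(k 0 1)) • ((1 : SL(2, ℤ)) : Coset (Gamma1 N)) by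
        rw [MulAction.Quotient.smul_mk, smul_eq_mul, mul_one], sind_T_zpow_smul]
  · have hd : k 1 1 = -1 := by
      rw [ha] at hdet
      linarith
    have hk : k = -T ^ (-(k 0 1)) := by
      ext i j
      fin_cases i <;> fin_cases j <;>
        simp [ModularGroup.coe_T_zpow, Matrix.SpecialLinearGroup.coe_neg, ha, hd, hz]
    rw [hd, neg_one_mul, Int.cast_neg, neg_pow, mul_comm, mul_smul]
    congr 1
    rw [hk, inv_neg, ← zpow_neg, neg_neg, show (((-(T ^ (k 0 1))) : SL(2, ℤ)) : Coset (Gamma1 N)) =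
      (-(T ^ (k 0 1))) • ((1 : SL(2, ℤ)) : Coset (Gamma1 N)) by
        rw [MulAction.Quotient.smul_mk, smul_eq_mul, mul_one], sind_neg_smul, sind_T_zpow_smul]

include hn1 in
/-- **The boundary of Manin's chain of `(k, q)`**: `q₁ⁿ sind[k⁻¹Γ₁(N)] - (kq)₁ⁿ sind[Γ₁(N)]`.
[cite: Merel1994, §1.4 Prop. 6] -/
theorem total_sbdry_chainMM (k : SL(2, ℤ)) (q : Fin 2 → ℤ) :
    (sbdrySymbol (Gamma1 N) hn1).total (chainMM n (Gamma1 N) k q) =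
      (((q 1 : ℤ) : ℚ) ^ n) • sind n (Gamma1 N) ((k⁻¹ : SL(2, ℤ)) : Coset (Gamma1 N)) -
        (((act k q 1 : ℤ) : ℚ) ^ n) • sind n (Gamma1 N) ((1 : SL(2, ℤ)) : Coset (Gamma1 N)) := by
  suffices H : ∀ m : ℕ, ∀ (k : SL(2, ℤ)) (q : Fin 2 → ℤ), (k 1 0).natAbs = m →
      (sbdrySymbol (Gamma1 N) hn1).total (chainMM n (Gamma1 N) k q) =
        (((q 1 : ℤ) : ℚ) ^ n) • sind n (Gamma1 N) ((k⁻¹ : SL(2, ℤ)) : Coset (Gamma1 N)) -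
          (((act k q 1 : ℤ) : ℚ) ^ n) • sind n (Gamma1 N) ((1 : SL(2, ℤ)) : Coset (Gamma1 N))
    from H _ k q rfl
  intro m
  induction m using Nat.strong_induction_on with
  | _ m ih =>
    intro k q hk
    by_cases hz : k 1 0 = 0
    · rw [chainMM_of_eq_zero n _ hz, map_zero, sind_mk_inv_of_apply_one_zero hz q, sub_self]
    · rw [PolySymbol.total_chainMM_of_ne_zero _ hz,
        ih _ (hk ▸ natAbs_enext_lt hz) (enext k) _ rfl, sbdrySymbol_toFun, sbdryFun_def]
      have o1 : sind n (Gamma1 N) (((k * T ^ estep k)⁻¹ : SL(2, ℤ)) : Coset (Gamma1 N)) =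
          sind n (Gamma1 N) ((k⁻¹ : SL(2, ℤ)) : Coset (Gamma1 N)) := by
        rw [mul_inv_rev, ← zpow_neg,
          show (((T ^ (-estep k)) * k⁻¹ : SL(2, ℤ)) : Coset (Gamma1 N)) =
            T ^ (-estep k) • ((k⁻¹ : SL(2, ℤ)) : Coset (Gamma1 N)) from rfl, sind_T_zpow_smul]
      have o2 : sind n (Gamma1 N) (S⁻¹ • (((k * T ^ estep k)⁻¹ : SL(2, ℤ)) : Coset (Gamma1 N))) =
          sind n (Gamma1 N) (((enext k)⁻¹ : SL(2, ℤ)) : Coset (Gamma1 N)) := by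
        rw [MulAction.Quotient.smul_mk, smul_eq_mul, enext, mul_inv_rev (k * T ^ estep k) S]
      have c1 : ((act (T ^ estep k)⁻¹ q 1 : ℤ) : ℚ) ^ n = ((q 1 : ℤ) : ℚ) ^ n := by
        rw [act_T_zpow_inv_apply_one]
      have c2 : ((act S⁻¹ (act (T ^ estep k)⁻¹ q) 1 : ℤ) : ℚ) ^ n =
          (-((act (T ^ estep k)⁻¹ q 0 : ℤ) : ℚ)) ^ n := by
        rw [act_S_inv]
        simp
      have c3 : ((act (enext k) (act S⁻¹ (act (T ^ estep k)⁻¹ q)) 1 : ℤ) : ℚ) ^ n =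
          ((act k q 1 : ℤ) : ℚ) ^ n := by
        rw [enext, ← act_mul, mul_assoc (k * T ^ estep k), mul_inv_cancel, mul_one,
          act_mul, act_act_inv]
      rw [o1, o2, c1, c2, c3]
      abel

variable {p : ℕ} [NeZero p] (hp : p.Prime)

include hn1 in
/-- **The boundary of the formal Hecke image is `(1 + p^{n+1})` times the boundary** (`p ≡ 1 mod N`;
the `σ'ᵢ` define the same coset of `Γ₁(N)` as `σ`). [cite: Merel1994, §1.4 Prop. 5 and Prop. 6] -/
theorem total_sbdry_heckeChain (hpN : (p : ZMod N) = 1) (σ : Gamma0 N) (q : Fin 2 → ℤ) :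
    (sbdrySymbol (Gamma1 N) hn1).total (heckeChain n hp σ q) =
      ((1 : ℚ) + (p : ℚ) ^ (n + 1)) • (sbdrySymbol (Gamma1 N) hn1).total (chainMM n (Gamma1 N) σ q) := by
  have hpN' : ¬ p ∣ N := by
    intro hdvd
    have h1 : ((p - 1 : ℕ) : ZMod N) = 0 := by
      rw [Nat.cast_sub hp.one_le, hpN, Nat.cast_one, sub_self]
    rw [CharP.cast_eq_zero_iff (ZMod N) N] at h1
    have h2 := hp.two_le
    have := Nat.le_of_dvd (by omega) (hdvd.trans h1)
    omega
  have hcos : ∀ i : HeckeIdx N p,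
      ((((heckePermElt hp σ i : SL(2, ℤ)))⁻¹ : SL(2, ℤ)) : Coset (Gamma1 N)) =
        ((((σ : SL(2, ℤ)))⁻¹ : SL(2, ℤ)) : Coset (Gamma1 N)) := by
    intro i
    have h := heckeEps_perm hp σ i
    rw [heckeEps_eq_one hpN, heckeEps_eq_one hpN, one_mul, one_mul] at h
    rw [QuotientGroup.eq, inv_inv]
    have hmap : Gamma0Map N (heckePermElt hp σ i * σ⁻¹) = 1 := by
      have hu := isUnit_Gamma0Map N σ
      rw [← hu.mul_left_inj, ← map_mul, inv_mul_cancel_right, one_mul, h]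
    exact mem_gamma1_of_gamma0Map_eq_one N hmap
  have hsnd : ∀ i : HeckeIdx N p,
      act (heckePermElt hp σ i : SL(2, ℤ)) ((heckeRep p (heckePerm hp σ i).1).mulVec q) =
        (heckeRep p i.1).mulVec (act σ q) := by
    intro i
    rw [act, act, Matrix.mulVec_mulVec, heckePermElt_spec hp σ i, ← Matrix.mulVec_mulVec]
  rw [heckeChain, map_sum]
  simp_rw [total_sbdry_chainMM hn1, hcos, hsnd]
  rw [Finset.sum_sub_distrib, ← Finset.sum_smul, ← Finset.sum_smul,
    Fintype.sum_equiv (heckePermEquiv hp σ)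
      (fun i : HeckeIdx N p ↦ ((((heckeRep p (heckePerm hp σ i).1).mulVec q) 1 : ℤ) : ℚ) ^ n)
      (fun j : HeckeIdx N p ↦ ((((heckeRep p j.1).mulVec q) 1 : ℤ) : ℚ) ^ n) (fun i ↦ rfl),
    sum_heckeRep_mulVec_one_pow n hpN', sum_heckeRep_mulVec_one_pow n hpN', smul_sub, ← mul_smul,
    ← mul_smul]

end SChain

/-! ### The count, in every weight -/

section SCount

variable (N : ℕ) [NeZero N] {n : ℕ} (hn1 : 1 ≤ n)

include hn1 in
/-- **Manin–Drinfeld for the cusps above `∞`, in dimension form, every `n ≥ 1`**: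
`dim_ℚ ℚΛ + dim ⟨signed orbit indicators of SL(2, ℤ)/Γ₁(N)⟩ ≤ dim_ℚ(M/rel)`
(as `finrank_span_periodLatticeK1_add_le`, with the signed boundary symbols). [cite: Merel1994, §1.4 Prop. 5] -/
theorem finrank_span_periodLatticeK1_add_le' :
    Module.finrank ℚ (Submodule.span ℚ (periodLatticeK1 (N := N) n :
        Set (Module.Dual ℂ (CuspForm (Gamma1 N) (n + 2))))) +
      Module.finrank ℚ (Submodule.span ℚ (Set.range (sind n (Gamma1 N)))) ≤
        Module.finrank ℚ (MM n (Gamma1 N) ⧸ relK n (Gamma1 N)) := by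
  classical
  obtain ⟨p, hp, -, hpmod⟩ := Nat.exists_prime_gt_modEq_one 0 (NeZero.ne N)
  haveI : NeZero p := ⟨hp.ne_zero⟩
  have hpN : (p : ZMod N) = 1 := by
    have := (ZMod.natCast_eq_natCast_iff p 1 N).mpr hpmod
    rwa [Nat.cast_one] at this
  set P := periodSymbol N n with hPdef
  set B := sbdrySymbol (Gamma1 N) hn1 with hBdef
  set R := relK n (Gamma1 N) with hRdef
  set Pbar := R.liftQ P.total P.relK_le_ker with hPbar
  set Bbar := R.liftQ B.total B.relK_le_ker with hBbar
  set c : ℂ := 1 + (p : ℂ) ^ (n + 1) with hc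
  set Φℂ := (heckeT (Gamma1 N) (n + 2) p -
    c • (LinearMap.id : Module.End ℂ (CuspForm (Gamma1 N) (n + 2)))).dualMap with hΦℂ
  have hΦinj : Function.Injective Φℂ := by
    rw [hΦℂ, LinearMap.dualMap_injective_iff]
    exact (LinearMap.injective_iff_surjective).mp (heckeT_sub_eisenstein_injective hp hpN hn1)
  set Φ : Module.Dual ℂ (CuspForm (Gamma1 N) (n + 2)) →ₗ[ℚ]
    Module.Dual ℂ (CuspForm (Gamma1 N) (n + 2)) := Φℂ.restrictScalars ℚ with hΦ
  have hΦinj' : Function.Injective Φ := hΦinj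
  have hΦapply : ∀ φ, Φ φ = (heckeT (Gamma1 N) (n + 2) p).dualMap φ - c • φ := fun φ ↦ by
    rw [hΦ, LinearMap.restrictScalars_apply, hΦℂ]
    ext f
    simp [LinearMap.dualMap_apply]
  set C : Submodule ℚ (Module.Dual ℂ (CuspForm (Gamma1 N) (n + 2))) :=
    (LinearMap.ker B.total).map P.total with hCdef
  have hsmul : ∀ φ : Module.Dual ℂ (CuspForm (Gamma1 N) (n + 2)),
      ((1 : ℚ) + (p : ℚ) ^ (n + 1)) • φ = c • φ := fun φ ↦ by
    ext f
    change ((1 : ℚ) + (p : ℚ) ^ (n + 1)) • φ f = c * φ f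
    rw [Rat.smul_def, hc]
    push_cast
    rfl
  have hgen : ∀ (σ : Gamma0 N) (q : Fin 2 → ℤ), Φ (periodFunctionalK1 n σ q) ∈ C := by
    intro σ q
    refine ⟨heckeChain n hp σ q - ((1 : ℚ) + (p : ℚ) ^ (n + 1)) • chainMM n (Gamma1 N) σ q, ?_, ?_⟩
    · rw [SetLike.mem_coe, LinearMap.mem_ker, map_sub, map_smul,
        total_sbdry_heckeChain hn1 hp hpN, sub_self]
    · rw [map_sub, map_smul, total_period_heckeChain n hp hpN, total_period_chainMM, hΦapply,
        ← periodFunctionalK1_eq_pathFnl, hsmul]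
  set Λ := Submodule.span ℚ (periodLatticeK1 (N := N) n :
    Set (Module.Dual ℂ (CuspForm (Gamma1 N) (n + 2)))) with hΛ
  have hmapΛ : Λ.map Φ ≤ C := by
    rw [hΛ, Submodule.map_span, Submodule.span_le]
    rintro _ ⟨φ, hφ, rfl⟩
    change φ ∈ periodLatticeK1 (N := N) n at hφ
    induction hφ using AddSubgroup.closure_induction with
    | mem x hx =>
      obtain ⟨⟨σ, q⟩, rfl⟩ := hx
      exact hgen σ q
    | zero => rw [map_zero]; exact zero_mem _
    | add x y _ _ hx hy => rw [map_add]; exact add_mem hx hy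
    | neg x _ hx => rw [map_neg]; exact neg_mem hx
  set C' : Submodule ℚ (Module.Dual ℂ (CuspForm (Gamma1 N) (n + 2))) :=
    (LinearMap.ker Bbar).map Pbar with hC'def
  have hCC' : C ≤ C' := by
    rintro _ ⟨m, hm, rfl⟩
    refine ⟨Submodule.Quotient.mk m, ?_, ?_⟩
    · rw [SetLike.mem_coe, LinearMap.mem_ker, hBbar, Submodule.liftQ_apply]
      exact hm
    · rw [hPbar, Submodule.liftQ_apply]
  have h1 : Module.finrank ℚ Λ = Module.finrank ℚ (Λ.map Φ) :=
    (LinearEquiv.finrank_eq (Submodule.equivMapOfInjective Φ hΦinj' Λ))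
  have h2 : Module.finrank ℚ (Λ.map Φ) ≤ Module.finrank ℚ C' := Submodule.finrank_mono (hmapΛ.trans hCC')
  have h3 : Module.finrank ℚ C' ≤ Module.finrank ℚ (LinearMap.ker Bbar) := Submodule.finrank_map_le _ _
  have h4 := LinearMap.finrank_range_add_finrank_ker Bbar
  have h5 : LinearMap.range Bbar = Submodule.span ℚ (Set.range (sind n (Gamma1 N))) := by
    rw [hBbar, Submodule.range_liftQ, hBdef, range_total_sbdrySymbol]
  rw [h5] at h4
  omega

end SCount

/-! ### `dim ⟨sind⟩ ≥ ε_∞` for `N ≥ 5`, and the rank half in every weight -/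

section SGlue

variable (N : ℕ) [NeZero N] {n : ℕ}

open scoped Classical in
/-- The support of a signed indicator lies over one `⟨T⟩`-orbit of `SL(2, ℤ)/±Γ₁(N)`. [folklore] -/
theorem sind_apply_eq_zero_of_base_ne {x y : Coset (Gamma1 N)}
    (h : Level.base (Gamma1pm N) (Subgroup.quotientMapOfLE (gamma1_le_gamma1pm N) y) ≠
      Level.base (Gamma1pm N) (Subgroup.quotientMapOfLE (gamma1_le_gamma1pm N) x)) :
    sind n (Gamma1 N) x y = 0 := by
  have key : ∀ z : Coset (Gamma1 N), Level.base (Gamma1pm N)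
      (Subgroup.quotientMapOfLE (gamma1_le_gamma1pm N) z) =
        Level.base (Gamma1pm N) (Subgroup.quotientMapOfLE (gamma1_le_gamma1pm N) x) →
      ∀ m : ℤ, T ^ m • z ≠ y := by
    intro z hz m hm
    apply h
    rw [← hm]
    change Level.base (Gamma1pm N) (proj (gamma1_le_gamma1pm N) (T ^ m • z)) = _
    rw [proj_smul (gamma1_le_gamma1pm N), Level.base_T_zpow_smul]
    exact hz
  have hx : ¬ ∃ m : ℤ, T ^ m • x = y := fun ⟨m, hm⟩ ↦ key x rfl m hm
  have hnx : ¬ ∃ m : ℤ, T ^ m • ((-1 : SL(2, ℤ)) • x) = y := fun ⟨m, hm⟩ ↦ by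
    refine key _ ?_ m hm
    change Level.base (Gamma1pm N) (proj (gamma1_le_gamma1pm N) ((-1 : SL(2, ℤ)) • x)) = _
    rw [proj_smul (gamma1_le_gamma1pm N), neg_one_smul_coset (neg_one_mem_gamma1pm N)]
  simp only [sind, tind, Pi.add_apply, Pi.smul_apply, if_neg hx, if_neg hnx, smul_zero, add_zero]

open scoped Classical in
/-- For `N ≥ 5` no translate `Tᵐx` is `-x`, so `sind x x = 1`. [folklore] -/
theorem sind_apply_self (hN : 5 ≤ N) (x : Coset (Gamma1 N)) : sind n (Gamma1 N) x x = 1 := by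
  have hnx : ¬ ∃ m : ℤ, T ^ m • ((-1 : SL(2, ℤ)) • x) = x := by
    rintro ⟨m, hm⟩
    obtain ⟨i, hi⟩ := Level.exists_T_zpow_smul_eq (Γ := Gamma1 N) x (-m)
    apply T_pow_smul_ne_neg_smul_gamma1 N hN x i
    rw [← hi, zpow_neg, inv_smul_eq_iff, hm]
  simp only [sind, tind, Pi.add_apply, Pi.smul_apply, if_neg hnx, smul_zero, add_zero]
  rw [if_pos ⟨0, by simp⟩]

/-- **`ε_∞ = #basePoints(±Γ₁(N)) ≤ dim ⟨sind⟩`** for `N ≥ 5`: the signed indicators of lifts of the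
base points have pairwise disjoint supports and value `1` at their own point. [folklore] -/
theorem card_basePoints_le_finrank_span_sind (hN : 5 ≤ N) :
    (Level.basePoints (Gamma1pm N)).card ≤
      Module.finrank ℚ (Submodule.span ℚ (Set.range (sind n (Gamma1 N)))) := by
  classical
  -- lifts of the base points
  have hlift : ∀ b : Coset (Gamma1pm N), ∃ x : Coset (Gamma1 N),
      Subgroup.quotientMapOfLE (gamma1_le_gamma1pm N) x = b := fun b ↦ by
    induction b using QuotientGroup.induction_on with
    | H g => exact ⟨(g : Coset (Gamma1 N)), rfl⟩
  choose lift hlift using hlift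
  set F : Level.basePoints (Gamma1pm N) → (Coset (Gamma1 N) → ℚ) := fun b ↦ sind n (Gamma1 N) (lift b.1)
    with hF
  have hli : LinearIndependent ℚ F := by
    rw [linearIndependent_iff']
    intro s g hg i hi
    have h := congr_fun hg (lift i.1)
    rw [Finset.sum_apply, Pi.zero_apply, Finset.sum_eq_single i] at h
    · change g i • sind n (Gamma1 N) (lift i.1) (lift i.1) = 0 at h
      rw [sind_apply_self N hN, smul_eq_mul, mul_one] at h
      exact h
    · intro j _ hji
      change g j • sind n (Gamma1 N) (lift j.1) (lift i.1) = 0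
      have hbj : Level.base (Gamma1pm N) j.1 = j.1 := (Finset.mem_filter.mp j.2).2
      have hbi : Level.base (Gamma1pm N) i.1 = i.1 := (Finset.mem_filter.mp i.2).2
      have hne : Level.base (Gamma1pm N) (Subgroup.quotientMapOfLE (gamma1_le_gamma1pm N) (lift i.1)) ≠
          Level.base (Gamma1pm N) (Subgroup.quotientMapOfLE (gamma1_le_gamma1pm N) (lift j.1)) := by
        rw [hlift, hlift, hbj, hbi]
        exact fun h ↦ hji (Subtype.ext h.symm)
      rw [sind_apply_eq_zero_of_base_ne N hne, smul_zero]
    · intro hi'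
      exact absurd hi hi'
  have hle : Submodule.span ℚ (Set.range F) ≤ Submodule.span ℚ (Set.range (sind n (Gamma1 N))) :=
    Submodule.span_mono (by rintro _ ⟨b, rfl⟩; exact ⟨_, rfl⟩)
  calc (Level.basePoints (Gamma1pm N)).card = Fintype.card (Level.basePoints (Gamma1pm N)) :=
        (Fintype.card_coe _).symm
    _ = Module.finrank ℚ (Submodule.span ℚ (Set.range F)) := (finrank_span_eq_card hli).symm
    _ ≤ Module.finrank ℚ (Submodule.span ℚ (Set.range (sind n (Gamma1 N)))) :=
        Submodule.finrank_mono hle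

/-- **`rank_ℤ Λ ≤ 2 dim_ℂ S_{n+2}(Γ₁(N))` for every `n ≥ 1` and `N ≥ 5`** (both parities): the
count `12(dim ℚΛ + dim ⟨sind⟩) ≤ (n + 1)[SL(2, ℤ) : Γ₁(N)]` (`finrank_span_periodLatticeK1_add_le'`,
`twelve_mul_finrank_quotient_le`), `dim ⟨sind⟩ ≥ ε_∞`, and the all-weight dimension bound
`(n + 1)[SL(2, ℤ) : ±Γ₁(N)] - 6ε_∞ ≤ 12 dim S_{n+2}(Γ₁(N))` (`le_twelve_mul_finrank_cuspForm_gamma1_all`).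
[cite: ShimuraIATAF1971, §8.2 Thm. 8.4 and (8.2.23)] -/
theorem finrank_span_periodLatticeK1_le_two_mul' (hN : 5 ≤ N) (hn1 : 1 ≤ n) :
    Module.finrank ℚ (Submodule.span ℚ (periodLatticeK1 (N := N) n :
      Set (Module.Dual ℂ (CuspForm (Gamma1 N) (n + 2))))) ≤
        2 * Module.finrank ℂ (CuspForm (Gamma1 N) (n + 2)) := by
  have hA := (Nat.mul_le_mul_left 12 (finrank_span_periodLatticeK1_add_le' N hn1)).trans
    (twelve_mul_finrank_quotient_le n (Gamma1 N) hn1 (gamma1_free (by omega)))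
  have hbp := card_basePoints_le_finrank_span_sind N (n := n) hN
  have hB := le_twelve_mul_finrank_cuspForm_gamma1_all N hN ((n : ℤ) + 2)
  have hidx := two_mul_index_gamma1pm_eq N (by omega)
  have hA' : (12 * (Module.finrank ℚ (Submodule.span ℚ (periodLatticeK1 (N := N) n :
      Set (Module.Dual ℂ (CuspForm (Gamma1 N) (n + 2))))) +
        Module.finrank ℚ (Submodule.span ℚ (Set.range (sind n (Gamma1 N))))) : ℤ) ≤
      ((n + 1) * (Gamma1 N).index : ℕ) := by exact_mod_cast hA
  have hbp' : ((Level.basePoints (Gamma1pm N)).card : ℤ) ≤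
      Module.finrank ℚ (Submodule.span ℚ (Set.range (sind n (Gamma1 N)))) := by exact_mod_cast hbp
  have hidx' : (2 * (Gamma1pm N).index : ℤ) = (Gamma1 N).index := by exact_mod_cast hidx
  push_cast at hA' hB
  have : (Module.finrank ℚ (Submodule.span ℚ (periodLatticeK1 (N := N) n :
      Set (Module.Dual ℂ (CuspForm (Gamma1 N) (n + 2))))) : ℤ) ≤
        2 * Module.finrank ℂ (CuspForm (Gamma1 N) (n + 2)) := by
    nlinarith [hA', hB, hidx', hbp']
  exact_mod_cast this

/-- **The rank half of the Eichler–Shimura isomorphism for `Γ₁(N)`, every weight `n + 2 ≥ 3`,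
`N ≥ 5`**: the period lattice of `S_{n+2}(Γ₁(N))` is the `ℤ`-span of `2 dim_ℂ S_{n+2}(Γ₁(N))`
functionals (Shimura 1971, Thm. 8.4 with Prop. 8.6). [cite: ShimuraIATAF1971, §8.2 Thm. 8.4 and §8.4 Prop. 8.6] -/
theorem periodLatticeK1_eq_span_fin_two_mul' (hN : 5 ≤ N) (hn1 : 1 ≤ n) :
    ∃ g : Fin (2 * Module.finrank ℂ (CuspForm (Gamma1 N) (n + 2))) →
        Module.Dual ℂ (CuspForm (Gamma1 N) (n + 2)),
      (periodLatticeK1 (N := N) n : Set (Module.Dual ℂ (CuspForm (Gamma1 N) (n + 2)))) =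
        Submodule.span ℤ (Set.range g) :=
  exists_coe_eq_span_range_of_finrank_span_le (periodLatticeK1 n) (periodLatticeK1_fg N n)
    (finrank_span_periodLatticeK1_le_two_mul' N hN hn1)

/-- **Shimura's full Hecke-stable lattice (3.5.20) in `S_{n+2}(Γ₁(N))^∨`** for `N ≥ 5`, `n ≥ 5`
(every parity). [cite: ShimuraIATAF1971, (3.5.20) and Thm. 8.4] -/
theorem nonempty_heckeStableRealLattice' (hN : 5 ≤ N) (hn5 : 5 ≤ n) :
    Nonempty (HeckeStableRealLattice N (n + 2)) := by
  obtain ⟨g, hg⟩ := periodLatticeK1_eq_span_fin_two_mul' N (n := n) hN (by omega)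
  exact ⟨heckeStableRealLatticeOfGenerators hn5 g hg⟩

/-- **Deligne–Serre 1974, (2.7.2) in every weight at every level `N ≥ 5`**
(`DeligneSerre1974_span_integralLattice1 N k`): weights `k ≥ 7` from the Hecke-stable lattice
(Shimura Thm. 3.52, `DeligneSerre1974_span_integralLattice1_of_heckeStableRealLattice`), all
weights by the `E₄`/`E₆` descent (`DeligneSerre1974_span_integralLattice1.of_forall_le`, Rem. 2.8).
[cite: DeligneSerreASENS1974, Prop. 2.7 (2.7.2) and Rem. 2.8] -/
theorem span_integralLattice1_of_five_le (hN : 5 ≤ N) (k : ℤ) :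
    DeligneSerre1974_span_integralLattice1 N k := by
  refine DeligneSerre1974_span_integralLattice1.of_forall_le (K₀ := 7) (fun k' hk' ↦ ?_) k
  obtain ⟨n, rfl⟩ : ∃ n : ℕ, k' = (n : ℤ) + 2 := ⟨(k' - 2).toNat, by omega⟩
  exact DeligneSerre1974_span_integralLattice1_of_heckeStableRealLattice (by omega)
    (nonempty_heckeStableRealLattice' N hN (by omega)).some

end SGlue

end ManinK

end Literature.NumberTheory.EllipticCurves.ModularForms
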